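import Summits.HodgeConjecture.HodgeConjecture.Theorems.PadicSemiregularLiftPadicPridhamSemiregularityOfObstruction
import Literature.AlgebraicGeometry.Deformation.AdaptedSigmaAdditivity
import Literature.AlgebraicGeometry.Deformation.ObstructionClassWellDefined
import Literature.AlgebraicGeometry.Deformation.ObstructionClassOfLift
import Literature.AlgebraicGeometry.Deformation.LiftOfVanishingClass
import HarnessLib

/-!
# `PadicPridhamSemiregularity` (stmt-HodgeConjecture-13815): the Illusie obstruction package H′, and the crux

The registered reshaped heart H′ = `stub_illusieObstructionAdditiveSep` of line `sigma-ob-kzero-additivity`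
(crux `PadicPridhamSemiregularity`, route `HodgeConjecture/PadicSemiregularLift`), PROVED from the Čech model
of the obstruction class built by the three route provers (2026-08-16):

* the obstruction CLASS of a finite locally free `F` on `Z₀` across a first-order thickening `i : Z₀ ↪ Z₁`
  (`Z₁` separated), read on `Y` (`j : Y ↪ Z₀` a closed immersion, `eI : i_* j_* 𝒪_Y ≅ 𝓘`):
  `cl(F) = [toLocalFamily κ(c)] ∈ Ext²(j^*F, j^*F)` for the affine point-indexed datum
  (`Deformation/DefectCochain.lean`, `Modules/CechEndCochainFamily.lean`, `Modules/CechTheta.lean`),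
  independent of the datum (`classOf_obstruction_eq`, `Deformation/ObstructionClassWellDefined.lean`);
* `Ob(F) := (Ext²(E, E ⊗ 𝒪) ≃ Ext²(E, E))⁻¹ cl(F)` (`obstructionGroupUnitEquiv`);
* (B) `Ob(F) = 0 ↔ F` lifts: `exists_lift_of_classOf_eq_zero` (`Deformation/LiftOfVanishingClass.lean`) and
  `classOf_obstruction_eq_zero_of_iso_pullback` (`Deformation/ObstructionClassOfLift.lean`);
* (A) `σ₀ ∘ Ob`, `σ₁ ∘ Ob` are additive on short exact sequences: adapted affine data exist
  (`exists_adaptedData`), the three classes may be computed there (datum independence), and there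
  `σ₀`, `σ₁` are additive (`sigmaZero_classOf_adapted`, `sigmaOne_classOf_adapted`,
  `Deformation/AdaptedSigmaAdditivity.lean`: block upper triangular cocycles, `Tr[ω] = [tr ω]`,
  `[ω] ∘ At = [ω ∪ At-cocycle]`).

Then `padicPridhamSemiregularity_of_obstructionAdditiveSep` (the kernel-checked composition of the line:
tower geometry G1–G3′, T, and the K₀-factorisation) gives the ROUTE DECL by name.
-/

noncomputable section

open CategoryTheory CategoryTheory.Abelian AlgebraicGeometry Opposite TopologicalSpace
open Literature.AlgebraicGeometry.Motives Literature.AlgebraicGeometry.Deformation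
  Literature.AlgebraicGeometry.HodgeTheory Literature.AlgebraicGeometry.Modules

-- the mandated namespace `Summit.HodgeConjecture.HodgeConjecture.…` repeats a component
set_option linter.dupNamespace false

namespace Summit.HodgeConjecture.HodgeConjecture.Theorems.PadicPridhamSemiregularity

section Datum

variable {Z₀ Z₁ : Scheme.{0}} (i : Z₀ ⟶ Z₁)

/-- **Affine point-indexed frame covers exist**: a finite locally free `F` on `Z₀` is framed over the
preimages of affine opens `U_x ∋ i(x)` of `Z₁`, `x ∈ Z₀` (affine opens form a basis; `i` is a closed
embedding). [folklore] -/
theorem exists_affineFrameCover [IsClosedImmersion i] (F : Z₀.Modules) (hF : IsFiniteLocallyFree F) :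
    ∃ C : FrameCover i F Z₀, (∀ x, IsAffineOpen (C.U x)) ∧ ∀ x, i.base x ∈ C.U x := by
  classical
  have key : ∀ x : Z₀, ∃ U : Z₁.Opens, IsAffineOpen U ∧ i.base x ∈ U ∧ i ⁻¹ᵁ U ≤ trivNbhd hF x :=
    fun x => exists_isAffineOpen_preimage_le (i := i) (mem_trivNbhd hF x)
  choose U hU hx hle using key
  exact ⟨{ U := U
           I := fun x => TrivIndex hF x
           e := fun x => SheafOfModules.restrictTrivialisation (R := Z₀.ringCatSheaf) (homOfLE (hle x))
             (trivFrame hF x) }, hU, hx⟩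

variable {i} {Y : Scheme.{0}} (j : Y ⟶ Z₀)

/-- The base opens `j⁻¹i⁻¹U_x` of a point-indexed frame cover with `i(x) ∈ U_x` cover `Y`. [folklore] -/
lemma iSup_baseFraming_U_eq_top {F : Z₀.Modules} (C : FrameCover i F Z₀) (hC : ∀ x, i.base x ∈ C.U x) :
    iSup (C.baseFraming j).U = ⊤ :=
  top_le_iff.mp fun y _ => Opens.mem_iSup.mpr ⟨j.base y, hC _⟩

/-- The base opens of a frame cover whose opens cover `Z₁` cover `Y`. [folklore] -/
lemma iSup_baseOpen_eq_top {ι : Type} (U : ι → Z₁.Opens) (hU : ⨆ a, U a = ⊤) :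
    (⨆ a, baseOpen j i (U a)) = ⊤ := by
  refine top_le_iff.mp fun y _ => ?_
  have hy : i.base (j.base y) ∈ ⨆ a, U a := by rw [hU]; exact Opens.mem_top _
  obtain ⟨a, ha⟩ := Opens.mem_iSup.mp hy
  exact Opens.mem_iSup.mpr ⟨a, ha⟩

end Datum

/-- **H′ — the Illusie obstruction package, separated / ideal form** (the registered reshaped stub
`stub_illusieObstructionAdditiveSep` of `Cruxes/PadicPridhamSemiregularity/Lines/sigma-ob-kzero-additivity.lean`,
verbatim): across a first-order thickening `i : Z₀ ↪ Z₁` of a separated `Z₁`, with `j : Y ↪ Z₀` a closed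
immersion and `eI : i_* j_* 𝒪_Y ≅ 𝓘`, there is an obstruction `Ob(F) ∈ Ext²_Y(j^*F, j^*F ⊗ 𝒪_Y)` for finite
locally free `F` on `Z₀` with (B) `Ob(F) = 0 ↔ F` lifts to a finite locally free module on `Z₁`, and (A)
`σ₀ ∘ Ob`, `σ₁ ∘ Ob` additive on short exact sequences. [cite: Hartshorne2010, §7, Thm. 7.1]
[cite: BuchweitzFlenner2003, Prop. 4.2] -/
theorem illusieObstructionAdditiveSep :
    ∀ (k : Type) [CommRing k] (Y : SchemeOver k) (Z₀ Z₁ : Scheme.{0}) (j : Y.left ⟶ Z₀)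
      [IsClosedImmersion j] (i : Z₀ ⟶ Z₁) [IsFirstOrderThickening i] [Z₁.IsSeparated],
      ((Scheme.Modules.pushforward i).obj ((Scheme.Modules.pushforward j).obj (unitModule Y.left)) ≅
        idealModule i) →
      ∃ Ob : ∀ (F : Z₀.Modules), IsFiniteLocallyFree F →
          obstructionGroup 2 ((Scheme.Modules.pullback j).obj F) (unitModule Y.left),
        (∀ (F : Z₀.Modules) (hF : IsFiniteLocallyFree F),
          Ob F hF = 0 ↔ ∃ F' : Z₁.Modules, IsFiniteLocallyFree F' ∧
            Nonempty ((Scheme.Modules.pullback i).obj F' ≅ F)) ∧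
        (∀ (S : ShortComplex Z₀.Modules), S.ShortExact → ∀ (h₁ : IsFiniteLocallyFree S.X₁)
          (h₂ : IsFiniteLocallyFree S.X₂) (h₃ : IsFiniteLocallyFree S.X₃),
          sigmaZeroObstruction (h₂.pullback j) (Ob S.X₂ h₂) =
              sigmaZeroObstruction (h₁.pullback j) (Ob S.X₁ h₁) +
                sigmaZeroObstruction (h₃.pullback j) (Ob S.X₃ h₃) ∧
            sigmaOneObstruction (h₂.pullback j) (Ob S.X₂ h₂) =
              sigmaOneObstruction (h₁.pullback j) (Ob S.X₁ h₁) +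
                sigmaOneObstruction (h₃.pullback j) (Ob S.X₃ h₃)) := by
  intro k _ Y Z₀ Z₁ j _ i _ _ eI
  classical
  -- the affine point-indexed datum of every finite locally free `F`
  choose C hCaff hCmem using fun (F : Z₀.Modules) (hF : IsFiniteLocallyFree F) =>
    exists_affineFrameCover i F hF
  have hC2 : ∀ (F : Z₀.Modules) (hF : IsFiniteLocallyFree F) (a b : Z₀),
      IsAffineOpen ((C F hF).U a ⊓ (C F hF).U b) := fun F hF a b => (hCaff F hF a).inf (hCaff F hF b)
  let L : ∀ (F : Z₀.Modules) (hF : IsFiniteLocallyFree F), (C F hF).Lifts := fun F hF =>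
    FrameCover.liftsOfIsAffineOpen _ (hC2 F hF)
  have hcovY : ∀ (F : Z₀.Modules) (hF : IsFiniteLocallyFree F), iSup ((C F hF).baseFraming j).U = ⊤ :=
    fun F hF => iSup_baseFraming_U_eq_top j (C F hF) (hCmem F hF)
  -- the obstruction class and the obstruction
  let cl : ∀ (F : Z₀.Modules) (hF : IsFiniteLocallyFree F),
      Ext ((Scheme.Modules.pullback j).obj F) ((Scheme.Modules.pullback j).obj F) 2 := fun F hF =>
    Cech.classOf (Cech.exactAugmentation ((C F hF).baseFraming j).U _ (hcovY F hF))
      (((C F hF).baseFraming j).toLocalFamily ((L F hF).defectCochain eI))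
      (((C F hF).baseFraming j).dFamily_toLocalFamily_eq_zero _ ((L F hF).D₂_defectCochain eI))
  refine ⟨fun F hF => (obstructionGroupUnitEquiv _ 2).symm (cl F hF), fun F hF => ?_, ?_⟩
  · -- (B) the lifting criterion at class level
    rw [AddEquiv.map_eq_zero_iff]
    constructor
    · intro h0
      exact (L F hF).exists_lift_of_classOf_eq_zero eI (hCaff F hF) (fun x => i.base x) (hCmem F hF)
        (fun y => ⟨j.base y, rfl⟩) (hF.pullback j) (hcovY F hF) h0
        (fun z => by obtain ⟨x, rfl⟩ := i.surjective z; exact ⟨x, hCmem F hF x⟩)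
    · rintro ⟨F', hF', ⟨φ⟩⟩
      exact (L F hF).classOf_obstruction_eq_zero_of_iso_pullback eI (hCaff F hF) (hcovY F hF) hF' φ _
  · -- (A) additivity of `σ₀ ∘ Ob`, `σ₁ ∘ Ob`: compute the three classes on adapted affine data
    intro S hS h₁ h₂ h₃
    obtain ⟨A, X, hX, hUaff, hU2, hcov, -⟩ := exists_adaptedData i hS h₁ h₃
    have hUY : iSup (fun a => baseOpen j i (A.U a)) = ⊤ := iSup_baseOpen_eq_top j A.U hcov
    let L₁ : A.cover₁.Lifts := FrameCover.liftsOfIsAffineOpen _ hU2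
    let L₃ : A.cover₃.Lifts := FrameCover.liftsOfIsAffineOpen _ hU2
    -- datum independence: move each `cl` to the adapted datum
    have e₁ := FrameCover.Lifts.classOf_obstruction_eq L₁ (L S.X₁ h₁) eI
      (hUY : iSup (A.cover₁.baseFraming j).U = ⊤) (hcovY S.X₁ h₁) (fun p => (hUaff p.1).inf (hCaff _ h₁ p.2))
      (FrameCover.Lifts.dFamily_toLocalFamily_defectCochain eI _)
      (FrameCover.Lifts.dFamily_toLocalFamily_defectCochain eI _)
    have e₂ := FrameCover.Lifts.classOf_obstruction_eq
      (AdaptedFrameCover.Lifts.adapted (hS := hS) L₁ L₃ X hX) (L S.X₂ h₂) eI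
      (hUY : iSup ((A.cover₂ hS).baseFraming j).U = ⊤) (hcovY S.X₂ h₂)
      (fun p => (hUaff p.1).inf (hCaff _ h₂ p.2))
      (FrameCover.Lifts.dFamily_toLocalFamily_defectCochain eI _)
      (FrameCover.Lifts.dFamily_toLocalFamily_defectCochain eI _)
    have e₃ := FrameCover.Lifts.classOf_obstruction_eq L₃ (L S.X₃ h₃) eI
      (hUY : iSup (A.cover₃.baseFraming j).U = ⊤) (hcovY S.X₃ h₃) (fun p => (hUaff p.1).inf (hCaff _ h₃ p.2))
      (FrameCover.Lifts.dFamily_toLocalFamily_defectCochain eI _)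
      (FrameCover.Lifts.dFamily_toLocalFamily_defectCochain eI _)
    simp only [sigmaZeroObstruction_apply, sigmaOneObstruction_apply, AddEquiv.apply_symm_apply]
    change sigmaZero _ (cl S.X₂ h₂) = sigmaZero _ (cl S.X₁ h₁) + sigmaZero _ (cl S.X₃ h₃) ∧
      sigmaOne _ (cl S.X₂ h₂) = sigmaOne _ (cl S.X₁ h₁) + sigmaOne _ (cl S.X₃ h₃)
    simp only [cl]
    rw [e₁, e₂, e₃]
    exact ⟨sigmaZero_classOf_adapted eI (hS := hS) L₁ L₃ X hX (h₁.pullback j) (h₂.pullback j)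
        (h₃.pullback j) hUY _ _ _,
      sigmaOne_classOf_adapted eI (hS := hS) L₁ L₃ X hX (h₁.pullback j) (h₂.pullback j)
        (h₃.pullback j) hUY _ _ _⟩

/-- **The crux `PadicPridhamSemiregularity` (stmt-HodgeConjecture-13815), PROVED**: H′ fed into the
kernel-checked composition `padicPridhamSemiregularity_of_obstructionAdditiveSep` (tower geometry G1–G3′,
invariance T, K₀-factorisation). -/
theorem padicPridhamSemiregularity_proof :
    Summit.HodgeConjecture.HodgeConjecture.Theses.PadicSemiregularLift.PadicPridhamSemiregularity :=
  padicPridhamSemiregularity_of_obstructionAdditiveSep illusieObstructionAdditiveSep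

end Summit.HodgeConjecture.HodgeConjecture.Theorems.PadicPridhamSemiregularity

end
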